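import Literature.NumberTheory.Automorphic.Liu2021.Thm418AsPrinted
import Mathlib.CategoryTheory.IsConnected
import Mathlib.CategoryTheory.Discrete.Basic
import HarnessLib

/-!
# Liu 2021, Proposition 4.6 (1) — EXACTLY AS PRINTED (statement-exact sibling record of `Thm418AsPrinted`; no proof)

[Liu2021] = Yifeng Liu, *Fourier–Jacobi cycles and arithmetic relative trace formula*, Cambridge J. Math. **9**
(2021), no. 1, 1–147 = arXiv:2102.11518.  PRIMARY SOURCE READ FOR THIS FILE: the author's TeX source of the arXiv v2
e-print, `FJcycle.tex` (md5 `6db49a74122d2cb0f224fa1b39488a0c`, 7163 lines; held at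
`run/shared/lean/pub/pub-hodgecm/pub-hodgecm-cf-kudla-howe-rallis-g4/lit/Liu21-arxiv-src/FJcycle.tex`); every `l. NNNN`
is a line of that file, `pNNNN Lk` a chunk/line of the held extraction `paper:arxiv-2102.11518` (chunk numbers are NOT
journal pages; Cambridge J. Math. page numbers are not held — `acq-07613` open — and are not quoted).  Numbering = compiled
arXiv v1 = v2 = the journal's theorem numbering (cell record `HOME/lit/LIU2021.md` §0, finding F-11).

## What this file is, and why

A SIBLING of `Literature.NumberTheory.Automorphic.Liu2021.Thm418AsPrinted` (tree, p277833): item (1) of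
**Proposition 4.6** typed over THE SAME datum `Thm418Data F E` plus ONE further ⟨CARRIER⟩ — the MORPHISMS of the
category `𝒜(μ)` (the datum of Thm. 4.18 carries only its objects, `D.Obj`).  Nothing is asserted; no face-scope guard.
It exists because the stage-2 junction `Model.faceSupply_of_thm418AsPrinted_pinned` (cell file
`Transposition/Item6SupplyPinned.lean`, binder `hObj : Nonempty D.Obj`) consumes, BESIDE `(hLiu : Thm418AsPrinted D)`,
the existence of an object `D_μ ∈ 𝒜(μ)` — which is PRINTED, as Prop. 4.6 (1), and which the citation desk asked to be
cited AS PRINTED rather than hand-summarised (cell INBOX l. 3915; hodge-director INBOX l. 564: «(ii) Prop 4.6 (1)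
(l. 1966, hypothesis sentence l. 1967 “Let μ be as in Definition 4.5”, item (1) l. 1969 “The category 𝒜(μ) is a nonempty
and connected partially ordered set”) — EXACT … may be typed statement-exact as sibling AS-PRINTED records … (a) the
datum binder must be the SAME `D` as `Thm418AsPrinted`»).  `Prop46_1AsPrinted D 𝒜` is a PREDICATE on the consumer's
datum; `∀ D 𝒜, Prop46_1AsPrinted D 𝒜` is not claimed and is false on degenerate carriers (e.g. `Obj` empty).

## The printed text (verbatim, TeX macros resolved as in `Thm418AsPrinted`)

**Def. 4.5** (l. 1936–1964), hypothesis l. 1937: «Let `μ` be a conjugate symplectic automorphic character of weight one.»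
(3) (l. 1960): «We denote by `𝒜(μ)` the *category of CM data for `μ`*, whose objects are CM data `D_μ`, and morphisms
from `D_μ = (A_μ, i_μ, λ_μ, r_μ)` to `D'_μ = (A'_μ, i'_μ, λ'_μ, r'_μ)` are isogenies `φ : A_μ → A'_μ` satisfying
`φ ∘ i_μ(x) = i'_μ(x) ∘ φ` for every `x ∈ M_μ`, `φ^∨ ∘ λ'_μ ∘ φ = c λ_μ` for some element `c ∈ ℚ^×`, and
`r'_μ = φ_* ∘ r_μ`.»  (Items (1), (2), (4) of Def. 4.5 — `η_μ`, the quadruples `D_μ`, the dual datum `D_μ^∨` — are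
quoted on `Thm418Data.Obj` in `Thm418AsPrinted`.)

**PROPOSITION 4.6** (TeX label `pr:cm_data`, l. 1966–1973 = p0018 L79–84), VERBATIM:
«Let `μ` be as in Definition 4.5.
 (1) The category `𝒜(μ)` is a nonempty and connected partially ordered set.  [l. 1969]
 (2) The assignment sending `D_μ` to `D_μ^∨` induces an equivalence `𝒜(μ)^{op} ⥲ 𝒜(μ^c)` of categories.  [l. 1971]»
Proof of (1), l. 1975–1987 (quoted for the READINGS only): nonemptiness by Casselman's theorem [Shi71, Thm. 6] with
[Shi71, Lem. 1–2, Thm. 5] and [Den89, (2.1)]; «The connectedness of `𝒜(μ)` also follows from [Shi71, Theorem 5].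
Finally, the compatibility condition `r'_μ = φ_* ∘ r_μ` ensures that `𝒜(μ)` is a partially ordered set.»

Only item (1) is typed here (item (2) relates the categories for `μ` and `μ^c`, i.e. TWO data; it is not consumed by
the cell and is left to a later record).

## The typing

* Hypothesis «Let `μ` be as in Definition 4.5» = «a conjugate symplectic automorphic character of weight one» (l. 1937)
  = the datum's REAL `D.μ` with its two printed hypotheses `D.isConjugateSymplectic`, `D.hasWeight_one` — the SAME
  `μ` as Thm. 4.18's (Def. 4.16 l. 2219 repeats the phrase).  No other hypothesis is printed.
* ⟨CARRIER⟩ objects: `D.Obj` (as in `Thm418AsPrinted`).  ⟨CARRIER⟩ morphisms: a category structure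
  `𝒜 : CategoryTheory.SmallCategory D.Obj` — its `Hom D_μ D'_μ` stands for the set of isogenies `φ` of Def. 4.5 (3)
  quoted above, `id`/`comp` for identity and composition of isogenies.  It is an explicit argument of the record (the
  consumer supplies it with its datum), exactly like the carriers inside `D`.
* «nonempty» = `Nonempty D.Obj`.
* READING P1 («connected»): the standard categorical meaning — any two objects are joined by a finite zigzag of
  morphisms; Mathlib's `CategoryTheory.IsConnected` (which also records nonemptiness; `isPreconnected_zigzag` /
  `zigzag_isConnected` translate to and from the zigzag formulation — corollary `zigzag`).
* READING P2 («partially ordered set», said of a category): THIN — between any two objects there is at most one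
  morphism (Mathlib `Quiver.IsThin`).  This is what the printed proof establishes («the compatibility condition
  `r'_μ = φ_* ∘ r_μ` ensures that `𝒜(μ)` is a partially ordered set», l. 1984: an isogeny is determined by its action on
  `H_1^{dR}`, so the condition makes morphisms unique), and it is the property Rem. 4.17 / Def. 4.16 use (a colimit over
  a nonempty connected thin category).  A thin category is canonically equivalent to the poset of its isomorphism
  classes; literal antisymmetry ON OBJECTS («`D_μ → D'_μ` and `D'_μ → D_μ` force `D_μ = D'_μ` as quadruples») is NOT
  typed: it is not what the proof argues and fails for trivially isomorphic distinct quadruples such as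
  `(A, i, λ, r)` and `(A, i, 2λ, r)` (the identity is a morphism both ways, `c = 2`).  Flagged for the citation desk.

No hypothesis is added and none dropped; P1–P2 are the only interpretive choices.  NO PROOF (Track 2).

## References

* [Liu2021] Y. Liu, *Fourier–Jacobi cycles and arithmetic relative trace formula*, Camb. J. Math. 9 (2021) 1–147,
  arXiv:2102.11518 — Def. 4.5 (l. 1936–1964), Prop. 4.6 (l. 1966–1973) with proof (l. 1975–1987).
* [ShimuraIATAF1971] / [Shi71] G. Shimura 1971 (Casselman's theorem, Thm. 6; Thm. 5) and [Den89] C. Deninger 1989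
  (2.1) — the printed proof's inputs (not used here).
-/

noncomputable section

open NumberField CategoryTheory

namespace Literature.NumberTheory.Automorphic.Liu2021

/-! ## Proposition 4.6 (1), exactly as printed, over the datum of Theorem 4.18 -/

/-- **[Liu2021, Proposition 4.6 (1)] EXACTLY AS PRINTED** (`FJcycle.tex` l. 1966–1969 = `paper:arxiv-2102.11518`
p0018 L79–82), for the datum `D` of `Thm418AsPrinted` (standing hypotheses l. 1878: `F` totally real, `E/F`
totally imaginary quadratic — the instance arguments; «Let `μ` be as in Definition 4.5» = `D.μ` conjugate symplectic
of weight one; ⟨CARRIER⟩ objects `D.Obj`) and the ⟨CARRIER⟩ `𝒜` = the morphisms of `𝒜(μ)` (Def. 4.5 (3), l. 1960: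
«isogenies `φ : A_μ → A'_μ` satisfying `φ ∘ i_μ(x) = i'_μ(x) ∘ φ` for every `x ∈ M_μ`, `φ^∨ ∘ λ'_μ ∘ φ = c λ_μ` for
some element `c ∈ ℚ^×`, and `r'_μ = φ_* ∘ r_μ`», with their identities and composition):

«Let `μ` be as in Definition 4.5. (1) The category `𝒜(μ)` is a nonempty and connected partially ordered set.»

TYPED as the conjunction: `𝒜(μ)` has an object (`Nonempty D.Obj`) ∧ `𝒜(μ)` is connected (READING P1: Mathlib
`CategoryTheory.IsConnected` — any two objects are joined by a zigzag of morphisms) ∧ `𝒜(μ)` is thin (READING P2: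
«partially ordered set» = at most one morphism between any two objects, `Quiver.IsThin`; what the proof l. 1984
establishes).  A consumer takes `(h : Prop46_1AsPrinted D 𝒜)` for ITS OWN `D`, `𝒜`; `∀ D 𝒜, Prop46_1AsPrinted D 𝒜` is
not claimed.  NO PROOF (Track 2). [cite: Liu2021, Prop. 4.6 (1)] -/
def Prop46_1AsPrinted {F E : Type} [Field F] [NumberField F] [IsTotallyReal F] [Field E] [NumberField E] [Algebra F E]
    [IsTotallyComplex E] [Algebra.IsQuadraticExtension F E] (D : Thm418Data F E) (𝒜 : SmallCategory D.Obj) : Prop :=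
  letI : SmallCategory D.Obj := 𝒜
  Nonempty D.Obj ∧ IsConnected D.Obj ∧ Quiver.IsThin D.Obj

namespace Thm418Data

variable {F E : Type} [Field F] [NumberField F] [IsTotallyReal F] [Field E] [NumberField E] [Algebra F E]
  [IsTotallyComplex E] [Algebra.IsQuadraticExtension F E] {D : Thm418Data F E}

/-- Dot-notation alias: `D.Prop46_1AsPrinted 𝒜`. [cite: Liu2021, Prop. 4.6 (1)] -/
protected abbrev Prop46_1AsPrinted (D : Thm418Data F E) (𝒜 : SmallCategory D.Obj) : Prop :=
  Liu2021.Prop46_1AsPrinted D 𝒜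

/-- «nonempty»: an object `D_μ ∈ 𝒜(μ)` exists — EXACTLY the stage-2 junction's binder `hObj`
(`Item6SupplyPinned.lean` :173), which is thus Prop. 4.6 (1) AS PRINTED. [cite: Liu2021, Prop. 4.6 (1)] -/
theorem nonempty_obj {𝒜 : SmallCategory D.Obj} (h : Liu2021.Prop46_1AsPrinted D 𝒜) : Nonempty D.Obj :=
  h.1

/-- «connected» (READING P1), in zigzag form: any two objects of `𝒜(μ)` are joined by a finite zigzag of morphisms.
[cite: Liu2021, Prop. 4.6 (1)] -/
theorem zigzag {𝒜 : SmallCategory D.Obj} (h : Liu2021.Prop46_1AsPrinted D 𝒜) (a b : D.Obj) :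
    letI : SmallCategory D.Obj := 𝒜; Zigzag a b := by
  letI : SmallCategory D.Obj := 𝒜
  haveI : IsConnected D.Obj := h.2.1
  exact isPreconnected_zigzag a b

/-- «partially ordered set» (READING P2): between two objects of `𝒜(μ)` there is at most one morphism.
[cite: Liu2021, Prop. 4.6 (1)] -/
theorem subsingleton_hom {𝒜 : SmallCategory D.Obj} (h : Liu2021.Prop46_1AsPrinted D 𝒜) (a b : D.Obj) :
    letI : SmallCategory D.Obj := 𝒜; Subsingleton (a ⟶ b) := by
  letI : SmallCategory D.Obj := 𝒜
  exact h.2.2 a b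

/-- **The binder is satisfiable** (hypothesis non-vacuity, not a statement about Liu's objects): over every CM extension
`E/F` as in l. 1878 there are a datum and a morphism carrier satisfying the record — the REAL hypotheses hold for a
weight-one conjugate symplectic `μ` (tree `IdeleClassGroup.exists_isConjugateSymplectic_hasCMType`), the other carriers
trivial, `Obj` the one-object discrete category.  Our bookkeeping. [cite: Liu2021, Prop. 4.6 (1)] -/
theorem prop46_1AsPrinted_satisfiable (F E : Type) [Field F] [NumberField F] [IsTotallyReal F] [Field E] [NumberField E]
    [Algebra F E] [IsTotallyComplex E] [Algebra.IsQuadraticExtension F E] :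
    ∃ (D : Thm418Data F E) (𝒜 : SmallCategory D.Obj), Liu2021.Prop46_1AsPrinted D 𝒜 := by
  letI : IsCMField E := isCMField F E
  obtain ⟨μ, hμ, hw, -⟩ := IdeleClassGroup.exists_isConjugateSymplectic_hasCMType (L := E)
    (IdeleClassGroup.cmTypeOf E (fun _ => -1) (by simp))
  refine ⟨⟨2, le_rfl, PUnit, PUnit, PUnit, fun _ => PUnit.unit, PUnit, μ, hμ, hw, Discrete PUnit, fun _ _ => PUnit,
    fun _ _ => 1, PUnit, 1, fun _ _ => PUnit, fun _ _ => 0⟩, inferInstance, ⟨⟨PUnit.unit⟩⟩, ?_, ?_⟩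
  · refine zigzag_isConnected fun j₁ j₂ => ?_
    obtain ⟨⟨⟩⟩ := j₁
    obtain ⟨⟨⟩⟩ := j₂
    exact Relation.ReflTransGen.refl
  · intro a b
    infer_instance

end Thm418Data

end Literature.NumberTheory.Automorphic.Liu2021

end
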